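import Mathlib

/- `set_option linter.dupNamespace false` as in the sibling kernel files (namespace `…Theorems.<FileStem>`). -/
set_option linter.dupNamespace false

/-!
# The Casimir double count on words: `N · Σ_{i≠j} ⟨H, P_{ij} H⟩ ≥ (d² − d N²) ‖H‖²` (decomp-mm · lens 3 · gen 23, part 1)

Context: route `route-MatrixMultiplication-ObstructionDescent` (`ω(ℂ) = 2`), attacked leaf
`E = NoPolyDegreeObstruction` (item 30889), DEGREE axis; aside `GapOneEquationsVanish` (item 27778):
`I_d(σ_{d-1}(ℂ^N ⊗ ℂ^N ⊗ ℂ^N)) = 0` for `d ≥ 3N − 2`.  This part is ONE slot group of the Casimir argument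
(finite-dimensional, MM-free, polynomial-free):

* `§1` words `Fin d → Fin N`, the split-at-a-slot equivalence and its interaction with `Function.update` / `swap`;
* `§2` for `H : (Fin d → Fin N) → ℝ` the raising operators `(E_{a b} H)(α) = Σ_i [α i = a] H(α[i ↦ b])` satisfy
  `Σ_{a,b} ‖E_{b a} H‖² = d·N·‖H‖² + Σ_{i ≠ j} ⟨H, P_{ij} H⟩` (`sum_raise_sq`, the Casimir identity of `gl_N` on
  `(ℝ^N)^{⊗d}` written out as a double count) and hence the Jucys–Murphy / content bound
  `N · Σ_{i≠j} ⟨H, P_{ij} H⟩ ≥ (d² − d N²) ‖H‖²` (`key_ineq`; keep the diagonal operators `E_{a a}` = letter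
  multiplicities and apply Cauchy–Schwarz to `Σ_a w_a = d`).

Part 2 (`ObstructionDescentPairCasimir`) sums three slot groups against the pair-exchange relations.
References: Landsberg–Manivel, Found. Comput. Math. 4 (2004) Lemma 3.1 / Cor. 3.4 (prolongation);
Landsberg, *Geometry and Complexity Theory* (2017) Prop. 8.3.4.1.  The content/Casimir criterion is this cell's
(NODE-g23, Theorems A/B).
-/

namespace Summit.MatrixMultiplication.MatrixMultiplication.Theorems.ObstructionDescentCasimirCount

open Finset

variable {N d : ℕ}

/-! ## §1 Words and the split at a slot -/

/-- Words of length `d` over the alphabet `Fin N` (one slot group of a coefficient tensor). [this cell] -/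
abbrev Word (N d : ℕ) := Fin d → Fin N

/-- Split a word at slot `i` into its letter at `i` and the word on the other slots. [folklore] -/
def splitAt (i : Fin d) : Word N d ≃ Fin N × ({j : Fin d // j ≠ i} → Fin N) where
  toFun α := (α i, fun j => α j.1)
  invFun p k := if h : k = i then p.1 else p.2 ⟨k, h⟩
  left_inv α := by
    funext k
    by_cases h : k = i
    · subst h; simp
    · simp [h]
  right_inv p := by
    refine Prod.ext (by simp) ?_
    funext j
    simp [j.2]

/-- The letter at the split slot. [folklore] -/
@[simp] theorem splitAt_symm_apply_self (i : Fin d) (p : Fin N × ({j : Fin d // j ≠ i} → Fin N)) :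
    (splitAt i).symm p i = p.1 := by
  simp [splitAt]

/-- The letters off the split slot. [folklore] -/
theorem splitAt_symm_apply_of_ne (i : Fin d) (p : Fin N × ({j : Fin d // j ≠ i} → Fin N))
    {k : Fin d} (hk : k ≠ i) : (splitAt i).symm p k = p.2 ⟨k, hk⟩ := by
  simp [splitAt, hk]

/-- The second component of the split ignores the letter at the split slot. [folklore] -/
@[simp] theorem splitAt_apply_snd (i : Fin d) (α : Word N d) : (splitAt i α).2 = fun j => α j.1 := rfl

/-- The first component of the split is the letter at the split slot. [folklore] -/
@[simp] theorem splitAt_apply_fst (i : Fin d) (α : Word N d) : (splitAt i α).1 = α i := rfl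

/-- Updating the split slot = replacing the first component. [folklore] -/
theorem update_eq_splitAt_symm (i : Fin d) (α : Word N d) (a : Fin N) :
    Function.update α i a = (splitAt i).symm (a, (splitAt i α).2) := by
  funext k
  by_cases hk : k = i
  · subst hk; simp
  · rw [Function.update_of_ne hk, splitAt_symm_apply_of_ne i _ hk, splitAt_apply_snd]

/-- Updating the split slot of a reassembled word. [folklore] -/
theorem update_splitAt_symm (i : Fin d) (p : Fin N × ({j : Fin d // j ≠ i} → Fin N)) (a : Fin N) :
    Function.update ((splitAt i).symm p) i a = (splitAt i).symm (a, p.2) := by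
  rw [update_eq_splitAt_symm, Equiv.apply_symm_apply]

/-- Updating another slot of a reassembled word = updating the second component. [folklore] -/
theorem update_splitAt_symm_of_ne (i : Fin d) {j : Fin d} (hj : j ≠ i)
    (p : Fin N × ({j : Fin d // j ≠ i} → Fin N)) (a : Fin N) :
    Function.update ((splitAt i).symm p) j a = (splitAt i).symm (p.1, Function.update p.2 ⟨j, hj⟩ a) := by
  funext k
  by_cases hkj : k = j
  · subst hkj
    rw [Function.update_self, splitAt_symm_apply_of_ne i _ hj]
    simp
  · rw [Function.update_of_ne hkj]
    by_cases hki : k = i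
    · subst hki; simp
    · rw [splitAt_symm_apply_of_ne i _ hki, splitAt_symm_apply_of_ne i _ hki]
      simp only
      rw [Function.update_of_ne]
      exact fun h => hkj (congrArg Subtype.val h)

/-- Swapping the split slot with another slot, on a reassembled word. [folklore] -/
theorem splitAt_symm_comp_swap (i : Fin d) {j : Fin d} (hj : j ≠ i)
    (p : Fin N × ({j : Fin d // j ≠ i} → Fin N)) :
    (splitAt i).symm p ∘ ⇑(Equiv.swap i j)
      = (splitAt i).symm (p.2 ⟨j, hj⟩, Function.update p.2 ⟨j, hj⟩ p.1) := by
  funext k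
  simp only [Function.comp_apply]
  by_cases hki : k = i
  · subst hki
    rw [Equiv.swap_apply_left, splitAt_symm_apply_of_ne _ _ hj, splitAt_symm_apply_self]
  · by_cases hkj : k = j
    · subst hkj
      rw [Equiv.swap_apply_right, splitAt_symm_apply_self, splitAt_symm_apply_of_ne _ _ hki]
      simp
    · rw [Equiv.swap_apply_of_ne_of_ne hki hkj, splitAt_symm_apply_of_ne _ _ hki,
        splitAt_symm_apply_of_ne _ _ hki]
      simp only
      rw [Function.update_of_ne]
      exact fun h => hkj (congrArg Subtype.val h)

/-! ## §2 One slot group: raising operators, the Casimir double count, the content bound -/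

section OneGroup

variable (H : Word N d → ℝ)

/-- The raising operator `E_{a b}` of `gl_N` on `(ℝ^N)^{⊗d}` in coordinates:
`(E_{a b} H)(α) = Σ_i [α i = a] · H(α[i ↦ b])`. [folklore] -/
def raise (a b : Fin N) (α : Word N d) : ℝ :=
  ∑ i, if α i = a then H (Function.update α i b) else 0

/-- `‖H‖²`. [folklore] -/
def normSq : ℝ := ∑ α, H α ^ 2

/-- `Σ_{i ≠ j} ⟨H, P_{ij} H⟩` (twice the class sum of transpositions against `H`), indexed by ordered pairs. [folklore] -/
def exchSum : ℝ :=
  ∑ p : Fin d × Fin d, ∑ α, if p.1 = p.2 then 0 else H α * H (α ∘ ⇑(Equiv.swap p.1 p.2))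

/-- The multiplicity of the letter `a` in the word `α`. [folklore] -/
def weight (α : Word N d) (a : Fin N) : ℕ := #{i | α i = a}

/-- The multiplicities of the letters sum to the length. [folklore] -/
theorem sum_weight (α : Word N d) : ∑ a, (weight α a : ℝ) = d := by
  have h := Finset.card_eq_sum_card_fiberwise (f := α) (s := univ) (t := univ) fun _ _ => mem_univ _
  simp only [card_univ, Fintype.card_fin] at h
  unfold weight
  exact_mod_cast h.symm

/-- Cauchy–Schwarz on the multiplicities: `d² ≤ N · Σ_a w_a²`. [folklore] -/
theorem sq_le_mul_sum_weight_sq (α : Word N d) : (d : ℝ) ^ 2 ≤ N * ∑ a, (weight α a : ℝ) ^ 2 := by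
  have h := sq_sum_le_card_mul_sum_sq (s := (univ : Finset (Fin N))) (f := fun a => (weight α a : ℝ))
  rw [sum_weight] at h
  simpa using h

/-- `E_{a a}` is the multiplicity operator: `(E_{a a} H)(α) = w_a(α) · H(α)`. [folklore] -/
theorem raise_diag (a : Fin N) (α : Word N d) : raise H a a α = weight α a * H α := by
  unfold raise weight
  have : ∀ i, (if α i = a then H (Function.update α i a) else 0) = if α i = a then H α else 0 := by
    intro i
    split_ifs with h
    · rw [← h, Function.update_eq_self]
    · rfl
  simp_rw [this]
  rw [← Finset.sum_filter, Finset.sum_const, nsmul_eq_mul]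

/-- Summing `K(α[i ↦ a])` over all letters `a` and all words `α` counts every word `N` times. [folklore] -/
theorem sum_sum_update (K : Word N d → ℝ) (i : Fin d) :
    ∑ a, ∑ α, K (Function.update α i a) = N * ∑ α, K α := by
  have h1 : ∀ a : Fin N, ∑ α, K (Function.update α i a)
      = N * ∑ r : {j : Fin d // j ≠ i} → Fin N, K ((splitAt i).symm (a, r)) := by
    intro a
    rw [Fintype.sum_equiv (splitAt i) (fun α => K (Function.update α i a))
      (fun p => K ((splitAt i).symm (a, p.2))) (fun α => by rw [update_eq_splitAt_symm])]
    rw [Fintype.sum_prod_type]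
    simp
  have h2 : ∑ α, K α = ∑ a, ∑ r : {j : Fin d // j ≠ i} → Fin N, K ((splitAt i).symm (a, r)) := by
    rw [← Equiv.sum_comp (splitAt i).symm K, Fintype.sum_prod_type]
  rw [h2, Finset.mul_sum]
  exact Finset.sum_congr rfl fun a _ => h1 a

/-- The cross term of the double count: for `i ≠ j`,
`Σ_a Σ_α [α i = α j] H(α[i ↦ a]) H(α[j ↦ a]) = ⟨H, P_{ij} H⟩`. [folklore] -/
theorem sum_sum_ite_update_update {i j : Fin d} (hij : i ≠ j) :
    ∑ a, ∑ α, (if α i = α j then H (Function.update α i a) * H (Function.update α j a) else 0)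
      = ∑ α, H α * H (α ∘ ⇑(Equiv.swap i j)) := by
  have hj : j ≠ i := fun h => hij h.symm
  have h1 : ∀ a, ∑ α, (if α i = α j then H (Function.update α i a) * H (Function.update α j a) else 0)
      = ∑ r : {k : Fin d // k ≠ i} → Fin N,
          H ((splitAt i).symm (a, r)) * H ((splitAt i).symm (a, r) ∘ ⇑(Equiv.swap i j)) := by
    intro a
    rw [Fintype.sum_equiv (splitAt i) _
      (fun p => if p.1 = p.2 ⟨j, hj⟩ then H ((splitAt i).symm (a, p.2))
        * H ((splitAt i).symm (p.1, Function.update p.2 ⟨j, hj⟩ a)) else 0) ?_]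
    · rw [Fintype.sum_prod_type, Finset.sum_comm]
      refine Finset.sum_congr rfl fun r _ => ?_
      rw [Finset.sum_ite_eq' univ (r ⟨j, hj⟩), if_pos (mem_univ _), splitAt_symm_comp_swap i hj]
    · intro α
      have e1 : Function.update α i a = (splitAt i).symm (a, (splitAt i α).2) := update_eq_splitAt_symm i α a
      have e2 : Function.update α j a
          = (splitAt i).symm ((splitAt i α).1, Function.update (splitAt i α).2 ⟨j, hj⟩ a) := by
        rw [← update_splitAt_symm_of_ne i hj (splitAt i α) a, Equiv.symm_apply_apply]
      rw [e1, e2]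
      rfl
  simp_rw [h1]
  rw [← Fintype.sum_prod_type (f := fun p : Fin N × ({k : Fin d // k ≠ i} → Fin N) =>
    H ((splitAt i).symm p) * H ((splitAt i).symm p ∘ ⇑(Equiv.swap i j)))]
  exact (Fintype.sum_equiv (splitAt i) _ _ fun α => by simp).symm

/-- Expanding `Σ_b ‖·‖²` of the raising operators at one word: a double count over ordered slot pairs. [folklore] -/
theorem sum_raise_sq_point (a : Fin N) (α : Word N d) :
    ∑ b, raise H b a α ^ 2
      = ∑ p : Fin d × Fin d,
          if α p.1 = α p.2 then H (Function.update α p.1 a) * H (Function.update α p.2 a) else 0 := by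
  rw [Fintype.sum_prod_type]
  have e : ∀ b : Fin N, raise H b a α ^ 2 = ∑ i, ∑ j, if α i = b then
      (if α j = b then H (Function.update α i a) * H (Function.update α j a) else 0) else 0 := by
    intro b
    rw [raise, sq, Finset.sum_mul_sum]
    refine Finset.sum_congr rfl fun i _ => Finset.sum_congr rfl fun j _ => ?_
    by_cases h1 : α i = b <;> by_cases h2 : α j = b <;> simp [h1, h2]
  simp_rw [e]
  rw [Finset.sum_comm]
  refine Finset.sum_congr rfl fun i _ => ?_
  rw [Finset.sum_comm]
  refine Finset.sum_congr rfl fun j _ => ?_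
  rw [Finset.sum_ite_eq univ (α i), if_pos (mem_univ _)]
  by_cases h : α i = α j
  · rw [if_pos h, if_pos h.symm]
  · rw [if_neg h, if_neg (fun h' => h h'.symm)]

/-- THE CASIMIR DOUBLE COUNT: `Σ_α Σ_a Σ_b ‖E_{b a}‖²-terms = d·N·‖H‖² + Σ_{i≠j} ⟨H, P_{ij} H⟩`. [folklore] -/
theorem sum_raise_sq : ∑ α, ∑ a, ∑ b, raise H b a α ^ 2 = (d : ℝ) * N * normSq H + exchSum H := by
  simp_rw [sum_raise_sq_point]
  have step : ∑ α : Word N d, ∑ a : Fin N, ∑ p : Fin d × Fin d,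
      (if α p.1 = α p.2 then H (Function.update α p.1 a) * H (Function.update α p.2 a) else 0)
      = ∑ p : Fin d × Fin d, ∑ α : Word N d, ∑ a : Fin N,
      (if α p.1 = α p.2 then H (Function.update α p.1 a) * H (Function.update α p.2 a) else 0) := by
    calc _ = ∑ α : Word N d, ∑ p : Fin d × Fin d, ∑ a : Fin N,
          (if α p.1 = α p.2 then H (Function.update α p.1 a) * H (Function.update α p.2 a) else 0) :=
          Finset.sum_congr rfl fun α _ => Finset.sum_comm
      _ = _ := Finset.sum_comm
  rw [step]
  have hp : ∀ p : Fin d × Fin d, ∑ α : Word N d, ∑ a : Fin N,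
      (if α p.1 = α p.2 then H (Function.update α p.1 a) * H (Function.update α p.2 a) else 0)
      = (if p.1 = p.2 then (N : ℝ) * normSq H else 0)
        + ∑ α, (if p.1 = p.2 then 0 else H α * H (α ∘ ⇑(Equiv.swap p.1 p.2))) := by
    rintro ⟨i, j⟩
    by_cases hij : i = j
    · subst hij
      simp only [if_true, Finset.sum_const_zero, add_zero]
      rw [Finset.sum_comm, normSq, ← sum_sum_update (fun α => H α ^ 2) i]
      refine Finset.sum_congr rfl fun a _ => Finset.sum_congr rfl fun α _ => ?_
      rw [sq]
    · simp only [if_neg hij, zero_add]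
      rw [Finset.sum_comm]
      exact sum_sum_ite_update_update H hij
  simp_rw [hp]
  rw [Finset.sum_add_distrib, exchSum]
  congr 1
  rw [Fintype.sum_prod_type]
  simp only [Finset.sum_ite_eq, Finset.mem_univ, if_true, Finset.sum_const, card_univ, Fintype.card_fin,
    nsmul_eq_mul]
  ring

/-- THE CONTENT BOUND (Jucys–Murphy): `N · Σ_{i≠j} ⟨H, P_{ij} H⟩ ≥ (d² − d N²) ‖H‖²`. [this cell, NODE-g23 Thm B] -/
theorem key_ineq : ((d : ℝ) ^ 2 - d * N ^ 2) * normSq H ≤ N * exchSum H := by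
  have hcount := sum_raise_sq H
  -- keep only the diagonal raising operators `E_{a a}`
  have hdiag : ∑ α, ∑ a, (weight α a : ℝ) ^ 2 * H α ^ 2 ≤ ∑ α, ∑ a, ∑ b, raise H b a α ^ 2 := by
    refine Finset.sum_le_sum fun α _ => Finset.sum_le_sum fun a _ => ?_
    have h := Finset.single_le_sum (f := fun b => raise H b a α ^ 2) (fun b _ => sq_nonneg _) (mem_univ a)
    simpa [raise_diag, mul_pow] using h
  -- Cauchy–Schwarz on the multiplicities, word by word
  have hcs : (d : ℝ) ^ 2 * normSq H ≤ N * ∑ α, ∑ a, (weight α a : ℝ) ^ 2 * H α ^ 2 := by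
    rw [normSq, Finset.mul_sum, Finset.mul_sum]
    refine Finset.sum_le_sum fun α _ => ?_
    rw [← Finset.sum_mul, ← mul_assoc]
    exact mul_le_mul_of_nonneg_right (sq_le_mul_sum_weight_sq α) (sq_nonneg _)
  have hN : (0 : ℝ) ≤ N := Nat.cast_nonneg N
  nlinarith [mul_le_mul_of_nonneg_left hdiag hN]

end OneGroup


end Summit.MatrixMultiplication.MatrixMultiplication.Theorems.ObstructionDescentCasimirCount
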